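import Summits.QuantumFields.QCD.Theses.HeatSlicedQuarks
import Summits.QuantumFields.QCD.Theorems.HeatSlicedQuarksFreeKernelPowerCountingFourier
import Summits.QuantumFields.QCD.Theorems.HeatSlicedQuarksFreeKernelPowerCountingBounds

/-!
# Free benchmark: two-sided `t⁻²` power counting of the free Wilson heat kernel
(item stmt-QuantumFields-8877 `FreeKernelPowerCounting`, support of route HeatSlicedQuarks)

For the free (`U ≡ 1`), massless, `r = 1` Wilson–Dirac operator `D₀` of the tree on the four-torus
`(ℤ/L)⁴` (colour `Fin 3`, spin `Fin 4`) and `1 ≤ t ≤ L²`, the on-site heat kernel of `H = D₀ᴴD₀` is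
`e^{−tH}((x,a,α),(x,b,β)) = δ_{(a,α),(b,β)} · L⁻⁴ Σ_k e^{−t h(k)}`
(`HeatSlicedQuarksFreeKernelPowerCountingFourier`), with the scalar symbol
`h(k) = (Σ_μ (1 − cos θ_μ))² + Σ_μ sin² θ_μ`, `θ_μ = 2π k_μ.val / L`, which vanishes only at the
zero mode (the Wilson term lifts the doublers).  Sandwiching
`Σ_μ 4 sin²(θ_μ/2) ≤ h(k) ≤ Σ_μ [4(1 − cos θ_μ)² + sin² θ_μ]` factorises the momentum sum over the
four coordinates, and the one-dimensional bounds of `HeatSlicedQuarksFreeKernelPowerCountingBounds`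
(Jordan + Gaussian Riemann sum above, the `⌊L/(2π√t)⌋ + 1` small momenta below) give
`(e^{−2}/(2π))⁴ / t² ≤ L⁻⁴ Σ_k e^{−t h(k)} ≤ 16 / t²` (`fourierSum_two_sided`), whence the route
item `Summit.QuantumFields.QCD.Theses.HeatSlicedQuarks.FreeKernelPowerCounting` with
`c = (e^{−2}/(2π))⁴`, `C = 16` (`freeKernelPowerCounting_proof`).

References: Montvay–Münster, *Quantum Fields on a Lattice* §4.2 (free Wilson fermions in momentum
space); Rivasseau, *From Perturbative to Constructive Renormalization* (1991), Ch. I (power counting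
of sliced propagators).  Pure theorem file (no definitions).
-/


namespace Summit.QuantumFields.QCD.Theorems.HeatSlicedQuarks.FreeKernel

open Literature.MathematicalPhysics Literature.MathematicalPhysics.QuantumLattice
  Literature.MathematicalPhysics.QuantumFieldTheory Literature.Probability.LatticeModels
open Matrix Complex Finset
open scoped Real

noncomputable section

section Symbol

variable {L : ℕ}

/-- Lower bound on the scalar symbol: `Σ_μ 4 sin²(θ_μ/2) ≤ h(k)`, because
`4 sin²(θ/2) = sin² θ + (1 − cos θ)²` and `Σ_μ (1 − cos θ_μ)² ≤ (Σ_μ (1 − cos θ_μ))²`. -/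
theorem sum_four_sin_sq_le_symbol (k : TorusSite 4 L) :
    ∑ μ : Fin 4, 4 * Real.sin (π * (ZMod.val (k μ) : ℝ) / L) ^ 2 ≤
      (∑ μ : Fin 4, (1 - Real.cos (2 * π * (ZMod.val (k μ) : ℝ) / L))) ^ 2 +
        ∑ μ : Fin 4, Real.sin (2 * π * (ZMod.val (k μ) : ℝ) / L) ^ 2 := by
  have hw0 : ∀ μ : Fin 4, 0 ≤ 1 - Real.cos (2 * π * (ZMod.val (k μ) : ℝ) / L) := fun μ =>
    sub_nonneg.mpr (Real.cos_le_one _)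
  have hterm : ∀ μ : Fin 4, 4 * Real.sin (π * (ZMod.val (k μ) : ℝ) / L) ^ 2 =
      (1 - Real.cos (2 * π * (ZMod.val (k μ) : ℝ) / L)) ^ 2 +
        Real.sin (2 * π * (ZMod.val (k μ) : ℝ) / L) ^ 2 := by
    intro μ
    have h1 : 1 - Real.cos (2 * π * (ZMod.val (k μ) : ℝ) / L) =
        2 * Real.sin (π * (ZMod.val (k μ) : ℝ) / L) ^ 2 := by
      rw [show 2 * π * (ZMod.val (k μ) : ℝ) / L = 2 * (π * (ZMod.val (k μ) : ℝ) / L) by ring,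
        Real.cos_two_mul, Real.cos_sq']
      ring
    have h2 : Real.sin (2 * π * (ZMod.val (k μ) : ℝ) / L) ^ 2 =
        1 - Real.cos (2 * π * (ZMod.val (k μ) : ℝ) / L) ^ 2 := Real.sin_sq _
    nlinarith [h1, h2]
  simp only [Fin.sum_univ_four] at *
  rw [hterm 0, hterm 1, hterm 2, hterm 3]
  nlinarith [mul_nonneg (hw0 0) (hw0 1), mul_nonneg (hw0 0) (hw0 2), mul_nonneg (hw0 0) (hw0 3),
    mul_nonneg (hw0 1) (hw0 2), mul_nonneg (hw0 1) (hw0 3), mul_nonneg (hw0 2) (hw0 3)]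

/-- Upper bound on the scalar symbol: `h(k) ≤ Σ_μ [4(1 − cos θ_μ)² + sin² θ_μ]`
(`(a+b+c+d)² ≤ 4(a²+b²+c²+d²)`). -/
theorem symbol_le_sum (k : TorusSite 4 L) :
    (∑ μ : Fin 4, (1 - Real.cos (2 * π * (ZMod.val (k μ) : ℝ) / L))) ^ 2 +
        ∑ μ : Fin 4, Real.sin (2 * π * (ZMod.val (k μ) : ℝ) / L) ^ 2 ≤
      ∑ μ : Fin 4, (4 * (1 - Real.cos (2 * π * (ZMod.val (k μ) : ℝ) / L)) ^ 2 +
        Real.sin (2 * π * (ZMod.val (k μ) : ℝ) / L) ^ 2) := by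
  simp only [Fin.sum_univ_four]
  nlinarith [sq_nonneg (Real.cos (2 * π * (ZMod.val (k 0) : ℝ) / L) - Real.cos (2 * π * (ZMod.val (k 1) : ℝ) / L)),
    sq_nonneg (Real.cos (2 * π * (ZMod.val (k 0) : ℝ) / L) - Real.cos (2 * π * (ZMod.val (k 2) : ℝ) / L)),
    sq_nonneg (Real.cos (2 * π * (ZMod.val (k 0) : ℝ) / L) - Real.cos (2 * π * (ZMod.val (k 3) : ℝ) / L)),
    sq_nonneg (Real.cos (2 * π * (ZMod.val (k 1) : ℝ) / L) - Real.cos (2 * π * (ZMod.val (k 2) : ℝ) / L)),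
    sq_nonneg (Real.cos (2 * π * (ZMod.val (k 1) : ℝ) / L) - Real.cos (2 * π * (ZMod.val (k 3) : ℝ) / L)),
    sq_nonneg (Real.cos (2 * π * (ZMod.val (k 2) : ℝ) / L) - Real.cos (2 * π * (ZMod.val (k 3) : ℝ) / L))]

end Symbol

section FourierSum

variable (L : ℕ) [NeZero L]

/-- **Upper bound on the momentum sum**: for `1 ≤ t ≤ L²`, `Σ_k e^{−t h(k)} ≤ (2L/√t)⁴`. -/
theorem sum_torus_exp_symbol_le {t : ℝ} (ht : 1 ≤ t) (htL : t ≤ (L : ℝ) ^ 2) :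
    ∑ k : TorusSite 4 L, Real.exp (-(t * ((∑ μ : Fin 4, (1 - Real.cos (2 * π * (ZMod.val (k μ) : ℝ) / L))) ^ 2 +
        ∑ μ : Fin 4, Real.sin (2 * π * (ZMod.val (k μ) : ℝ) / L) ^ 2))) ≤
      (2 * L / Real.sqrt t) ^ 4 := by
  have ht0 : 0 ≤ t := le_trans zero_le_one ht
  calc ∑ k : TorusSite 4 L, Real.exp (-(t * ((∑ μ : Fin 4, (1 - Real.cos (2 * π * (ZMod.val (k μ) : ℝ) / L))) ^ 2 +
        ∑ μ : Fin 4, Real.sin (2 * π * (ZMod.val (k μ) : ℝ) / L) ^ 2)))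
      ≤ ∑ k : TorusSite 4 L, ∏ μ : Fin 4, Real.exp (-(4 * t * Real.sin (π * (ZMod.val (k μ) : ℝ) / L) ^ 2)) := by
        refine Finset.sum_le_sum fun k _ => ?_
        rw [← Real.exp_sum, Real.exp_le_exp, Finset.sum_neg_distrib]
        have h := sum_four_sin_sq_le_symbol k
        have : ∑ μ : Fin 4, 4 * t * Real.sin (π * (ZMod.val (k μ) : ℝ) / L) ^ 2 =
            t * ∑ μ : Fin 4, 4 * Real.sin (π * (ZMod.val (k μ) : ℝ) / L) ^ 2 := by
          rw [Finset.mul_sum]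
          refine Finset.sum_congr rfl fun μ _ => ?_
          ring
        rw [this, neg_le_neg_iff]
        exact mul_le_mul_of_nonneg_left h ht0
    _ = (∑ j : ZMod L, Real.exp (-(4 * t * Real.sin (π * (j.val : ℝ) / L) ^ 2))) ^ 4 :=
        sum_torus_prod_eq_pow (fun j : ZMod L => Real.exp (-(4 * t * Real.sin (π * (j.val : ℝ) / L) ^ 2)))
    _ ≤ (2 * L / Real.sqrt t) ^ 4 :=
        pow_le_pow_left₀ (Finset.sum_nonneg fun j _ => (Real.exp_pos _).le) (sum_zmod_exp_upper L ht htL) 4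

/-- **Lower bound on the momentum sum**: for `1 ≤ t`, `(e^{−2} L/(2π√t))⁴ ≤ Σ_k e^{−t h(k)}`. -/
theorem le_sum_torus_exp_symbol {t : ℝ} (ht : 1 ≤ t) :
    (Real.exp (-2) * (L / (2 * π * Real.sqrt t))) ^ 4 ≤
      ∑ k : TorusSite 4 L, Real.exp (-(t * ((∑ μ : Fin 4, (1 - Real.cos (2 * π * (ZMod.val (k μ) : ℝ) / L))) ^ 2 +
        ∑ μ : Fin 4, Real.sin (2 * π * (ZMod.val (k μ) : ℝ) / L) ^ 2))) := by
  have ht0 : 0 ≤ t := le_trans zero_le_one ht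
  calc (Real.exp (-2) * (L / (2 * π * Real.sqrt t))) ^ 4
      ≤ (∑ j : ZMod L, Real.exp (-(t * (4 * (1 - Real.cos (2 * π * (j.val : ℝ) / L)) ^ 2 +
          Real.sin (2 * π * (j.val : ℝ) / L) ^ 2)))) ^ 4 :=
        pow_le_pow_left₀ (by positivity) (sum_zmod_exp_lower L ht) 4
    _ = ∑ k : TorusSite 4 L, ∏ μ : Fin 4, Real.exp (-(t * (4 * (1 - Real.cos (2 * π * (ZMod.val (k μ) : ℝ) / L)) ^ 2 +
          Real.sin (2 * π * (ZMod.val (k μ) : ℝ) / L) ^ 2))) :=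
        (sum_torus_prod_eq_pow (fun j : ZMod L => Real.exp (-(t * (4 * (1 - Real.cos (2 * π * (j.val : ℝ) / L)) ^ 2 +
          Real.sin (2 * π * (j.val : ℝ) / L) ^ 2))))).symm
    _ ≤ ∑ k : TorusSite 4 L, Real.exp (-(t * ((∑ μ : Fin 4, (1 - Real.cos (2 * π * (ZMod.val (k μ) : ℝ) / L))) ^ 2 +
        ∑ μ : Fin 4, Real.sin (2 * π * (ZMod.val (k μ) : ℝ) / L) ^ 2))) := by
        refine Finset.sum_le_sum fun k _ => ?_
        rw [← Real.exp_sum, Real.exp_le_exp, Finset.sum_neg_distrib, ← Finset.mul_sum, neg_le_neg_iff]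
        exact mul_le_mul_of_nonneg_left (symbol_le_sum k) ht0

/-- **Two-sided free power counting of the Fourier sum**: for `1 ≤ t ≤ L²`,
`(e^{−2}/(2π))⁴ / t² ≤ L⁻⁴ Σ_k e^{−t h(k)} ≤ 16 / t²`. -/
theorem fourierSum_two_sided {t : ℝ} (ht : 1 ≤ t) (htL : t ≤ (L : ℝ) ^ 2) :
    (Real.exp (-2) / (2 * π)) ^ 4 / t ^ 2 ≤
        1 / (L : ℝ) ^ 4 * ∑ k : TorusSite 4 L, Real.exp (-(t * ((∑ μ : Fin 4, (1 - Real.cos (2 * π * (ZMod.val (k μ) : ℝ) / L))) ^ 2 +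
          ∑ μ : Fin 4, Real.sin (2 * π * (ZMod.val (k μ) : ℝ) / L) ^ 2))) ∧
      1 / (L : ℝ) ^ 4 * ∑ k : TorusSite 4 L, Real.exp (-(t * ((∑ μ : Fin 4, (1 - Real.cos (2 * π * (ZMod.val (k μ) : ℝ) / L))) ^ 2 +
          ∑ μ : Fin 4, Real.sin (2 * π * (ZMod.val (k μ) : ℝ) / L) ^ 2))) ≤ 16 / t ^ 2 := by
  have hL : (0 : ℝ) < L := by exact_mod_cast Nat.pos_of_ne_zero (NeZero.ne L)
  have ht0 : 0 < t := lt_of_lt_of_le one_pos ht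
  have hsq : Real.sqrt t ^ 4 = t ^ 2 := by
    rw [show (4 : ℕ) = 2 * 2 from rfl, pow_mul, Real.sq_sqrt ht0.le]
  have hL4 : (0 : ℝ) < (L : ℝ) ^ 4 := by positivity
  constructor
  · have h := le_sum_torus_exp_symbol L ht
    rw [show (Real.exp (-2) * (L / (2 * π * Real.sqrt t))) ^ 4 =
        (L : ℝ) ^ 4 * ((Real.exp (-2) / (2 * π)) ^ 4 / t ^ 2) by
      rw [← hsq]; field_simp] at h
    rw [one_div, le_inv_mul_iff₀ hL4]
    exact h
  · have h := sum_torus_exp_symbol_le L ht htL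
    rw [show (2 * L / Real.sqrt t) ^ 4 = (L : ℝ) ^ 4 * (16 / t ^ 2) by
      rw [← hsq]; field_simp; ring] at h
    rw [one_div, inv_mul_le_iff₀ hL4]
    exact h

end FourierSum

/-! ### The route item -/

/-- **Free benchmark `FreeKernelPowerCounting` (item stmt-QuantumFields-8877 of route HeatSlicedQuarks).**
For the free (`U ≡ 1`), massless, `r = 1` Wilson–Dirac operator on the four-torus of side `L` and
`1 ≤ t ≤ L²`, the on-site heat kernel `e^{−t D₀ᴴD₀}((x,a,α),(x,b,β))` is real, diagonal in
colour–spin and two-sided free: `c/t² ≤ e^{−tH}((x,a,α),(x,a,α))` and every on-site entry has modulus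
`≤ C/t²`, with `c = (e^{−2}/(2π))⁴`, `C = 16` (Fourier sum `L⁻⁴ Σ_k e^{−t h(k)}`,
`h(k) = (Σ_μ(1 − cos θ_μ))² + Σ_μ sin² θ_μ`, Jordan's inequality and the Gaussian Riemann sum for the
upper bound, the `≍ L⁴/t²` momenta with `|θ| ≤ 1/√t` for the lower bound). -/
theorem freeKernelPowerCounting_proof :
    Summit.QuantumFields.QCD.Theses.HeatSlicedQuarks.FreeKernelPowerCounting := by
  unfold Summit.QuantumFields.QCD.Theses.HeatSlicedQuarks.FreeKernelPowerCounting
  refine ⟨(Real.exp (-2) / (2 * π)) ^ 4, 16, by positivity, ?_⟩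
  intro L _ t ht htL x a α
  have hcfg : (fun _ : Edge 4 L => (1 : Matrix.specialUnitaryGroup (Fin 3) ℂ)) =
      (1 : GaugeConfig 4 L (Matrix.specialUnitaryGroup (Fin 3) ℂ)) := rfl
  rw [hcfg]
  obtain ⟨hlow, hup⟩ := fourierSum_two_sided L ht htL
  refine ⟨?_, fun b β => ?_⟩
  · rw [exp_freeWilson_apply_site, if_pos rfl, Complex.ofReal_re]
    exact hlow
  · rw [exp_freeWilson_apply_site]
    split_ifs
    · rw [Complex.norm_real, Real.norm_of_nonneg]
      · exact hup
      · exact mul_nonneg (by positivity) (Finset.sum_nonneg fun k _ => (Real.exp_pos _).le)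
    · rw [norm_zero]
      positivity

end

end Summit.QuantumFields.QCD.Theorems.HeatSlicedQuarks.FreeKernel
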